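import Summits.QuantumFields.BalabanUV.Beta.StencilExpSums
import Summits.QuantumFields.BalabanUV.Beta.ResolventFinCoefficients

/-!
# Beta / StencilExpSumsFinTube — THE FIN TAIL, THE (Z2b) TABLE SUPS AND A WORKED KERNEL INSTANCE of the exponential-sum discharge
# (β sub-cell, BINDER-OWNERS row CAP-k, lineage `b2b-balaban-beta-an5`, gen 28; node BETA-an5-g28-EXPSUM, sibling of `StencilExpSums`)

WHAT (continuing `StencilExpSums` §1–§3, same conventions: offsets as a LIST `L` with `L.toFinset = S`, RATIONAL table-norm bounds `ν x ≥ ‖K x‖`, the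
tree's checker `Literature.Analysis.ValidatedNumerics.ExpSum.checkUB` evaluated by `decide +kernel`):
* §4 THE FIN TAIL: `finRateQ`, `finTailTerms`, **`taylorTailFin_le_esum`**, `taylorTailFin_le_of_checkUB`, and on the admitted fin record (p229652 ∕ p235048)
  **`FinLeafRecord.certifies_ofCoeffs_ofTableNorms`** — its field `T` now CHECKED by `checkUB … r.T.num r.T.den = true` (rational fin data
  `σ, c, τ₀, hτ, hx`) instead of asserted through `hT : taylorTailFin ≤ r.T`.
* §5 THE (Z2b) TABLE SUPS: `tubeTerms L ν w`, **`norm_characterSum_le_esum_of_mem_tube`** (`CapRouteA.norm_characterSum_le_of_mem_tube` + table norms),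
  `…_of_mem_vertexTori`, **`tableSup_of_checkUB`** — `∀ q ∈ VertexTori κ, ‖Σ_x χ_q(x)•K x‖ ≤ Sκ` from ONE kernel check: literally the binder `hS i` of
  `CapWordListGL(Schedules).rowsGL_ofSchedulesQ_ofPairedBall` for a stencil letter —, `tubeSup_of_checkUB` (any rational half-widths).
* §6 WORKED KERNEL INSTANCE (non-vacuity + cost of the check): the 81-offset stencil `L81 = {−1,0,1}⁴`, `ν ≡ 1`, `κ = 9∕10`, `m = 4`, `h ≡ 1∕8`:
  `checkUB (2^64) 24 6 … = true` by `decide +kernel` (seconds on the farm) ⟹ **`taylorTail_L81_le`**: `taylorTail 4 … ≤ 243∕100` for EVERY table with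
  `‖K x‖ ≤ 1` and EVERY centre on the tube `|Im c_μ| ≤ 9∕10`; **`tableSup_L81_le`**: `‖Σ χ•K‖ ≤ 1228` on the vertex tori (`(1 + 2e^{0.9})⁴ = 1227.6…`);
  the lower checks `le_esum_tail81` (`242∕100 ≤ esum`), `le_esum_tube81` (`1227 ≤ esum`) show the enclosures are tight to the last digit stated.

HONEST FRAMING.  Kernel glue ([folklore]); no table, record or schedule of the cell supplied; 0 binders of the real row instantiated; 0 certified
coefficients; discharging `BetaPertH` would make Bałaban's ultraviolet stability UNCONDITIONAL — NOT the continuum limit, NOT the Clay problem.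
HONEST DEPENDENCY: continuum YM on T⁴ ⇐ BetaPertH ∧ nine spine estimates (0∕9 proved); BetaPertH ⇐ (D1) ∧ (D4) ∧ CAP+tail; G-an2-4 gates asym,
D1 and NE2∕3∕4.  0 `sorry`, 0 cite tags; `decide +kernel` only (no `native_decide`, axioms = the trio).
-/

/-! ## §4 The fin tail as an exponential sum; the admitted fin record with its `T` field CHECKED -/

namespace Summit.QuantumFields.BalabanUV.Beta.StencilExpSums

open Complex Set Matrix Finset
open Summit.QuantumFields.BalabanUV.Beta.PolyRegularAlgebra (character)
open Summit.QuantumFields.BalabanUV.Beta.TubeMaximumModulus (Tube VertexTori polyStrip_subset_tube vertexTori_subset_polyStrip)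
open Summit.QuantumFields.BalabanUV.Beta.ResolventBoxCertificate
open Summit.QuantumFields.BalabanUV.Beta.ResolventFinCertificate (finRate taylorTailFin finResidualCoeff)
open Summit.QuantumFields.BalabanUV.Beta.ResolventFinLeafRecord (FinLeafRecord)
open Summit.QuantumFields.BalabanUV.Beta.CapRouteA (norm_characterSum_le_of_mem_tube)
open Literature.Analysis.ValidatedNumerics.ExpSum (ETerm esum checkUB checkLB esum_le_of_checkUB le_esum_of_checkLB)
open scoped Real Matrix.Norms.L2Operator Pointwise

noncomputable section

variable {d : ℕ} {n : Type*} [Fintype n] [DecidableEq n]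

section FinTail

/-- the rational fin rate `R_i σ + Σ_k R_{succAbove i k} c_k`. [folklore] -/
def finRateQ (R : Fin (d + 1) → ℤ) (i : Fin (d + 1)) (σ : ℚ) (c : Fin d → ℚ) : ℚ :=
  R i * σ + ∑ k, (R (i.succAbove k) : ℚ) * c k

/-- cast of `finRateQ`. [folklore] -/
theorem cast_finRateQ (R : Fin (d + 1) → ℤ) (i : Fin (d + 1)) (σ : ℚ) (c : Fin d → ℚ) :
    ((finRateQ R i σ c : ℚ) : ℝ) = finRate R i (σ : ℝ) (fun k => ((c k : ℚ) : ℝ)) := by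
  simp only [finRateQ, finRate]; push_cast; rfl

/-- THE TERM LIST OF THE FIN TAIL: per frequency `R` the term `ν_R · tailFactor m (|r_R|·hτ + |R_i|·hx) · e^{−τ₀ r_R}`. [folklore] -/
def finTailTerms (m : ℕ) (L : List (Fin (d + 1) → ℤ)) (ν : (Fin (d + 1) → ℤ) → ℚ) (i : Fin (d + 1)) (σ : ℚ) (c : Fin d → ℚ)
    (τ₀ hτ hx : ℚ) : List ETerm :=
  L.map fun R => ratTerm (ν R * tailFactorQ m (|finRateQ R i σ c| * hτ + |(R i : ℚ)| * hx)) (-(τ₀ * finRateQ R i σ c))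

/-- **THE FIN TAIL IS BOUNDED BY THE EXPONENTIAL SUM OF ITS TERM LIST** (`hτ, hx ≥ 0`). [folklore] -/
theorem taylorTailFin_le_esum {m : ℕ} {L : List (Fin (d + 1) → ℤ)} {S : Finset (Fin (d + 1) → ℤ)} (hLS : L.toFinset = S)
    {K : (Fin (d + 1) → ℤ) → Matrix n n ℂ} {ν : (Fin (d + 1) → ℤ) → ℚ} (hν : ∀ x ∈ S, ‖K x‖ ≤ ν x)
    (i : Fin (d + 1)) (σ : ℚ) (c : Fin d → ℚ) (τ₀ : ℚ) {hτ hx : ℚ} (hhτ : 0 ≤ hτ) (hhx : 0 ≤ hx) :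
    taylorTailFin m S K i (σ : ℝ) (fun k => ((c k : ℚ) : ℝ)) (τ₀ : ℝ) (hτ : ℝ) (hx : ℝ) ≤ esum (finTailTerms m L ν i σ c τ₀ hτ hx) := by
  rw [finTailTerms, esum_map_ratTerm, taylorTailFin, ← hLS]
  have hterm : ∀ R ∈ L,
      Real.exp (-((τ₀ : ℝ) * finRate R i (σ : ℝ) (fun k => ((c k : ℚ) : ℝ))))
        * tailFactor m (|finRate R i (σ : ℝ) (fun k => ((c k : ℚ) : ℝ))| * (hτ : ℝ) + |(R i : ℝ)| * (hx : ℝ)) * ‖K R‖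
      ≤ ((ν R * tailFactorQ m (|finRateQ R i σ c| * hτ + |(R i : ℚ)| * hx) : ℚ) : ℝ)
        * Real.exp (((-(τ₀ * finRateQ R i σ c)) : ℚ) : ℝ) := by
    intro R hR
    have hRS : R ∈ S := by rw [← hLS, List.mem_toFinset]; exact hR
    have e1 : |finRate R i (σ : ℝ) (fun k => ((c k : ℚ) : ℝ))| * (hτ : ℝ) + |(R i : ℝ)| * (hx : ℝ)
        = (((|finRateQ R i σ c| * hτ + |(R i : ℚ)| * hx) : ℚ) : ℝ) := by
      push_cast; rw [cast_finRateQ]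
    have e2 : -((τ₀ : ℝ) * finRate R i (σ : ℝ) (fun k => ((c k : ℚ) : ℝ))) = (((-(τ₀ * finRateQ R i σ c)) : ℚ) : ℝ) := by
      push_cast; rw [cast_finRateQ]
    rw [e1, e2, Rat.cast_mul, cast_tailFactorQ]
    have ht0 : (0 : ℝ) ≤ (((|finRateQ R i σ c| * hτ + |(R i : ℚ)| * hx) : ℚ) : ℝ) := by
      have : (0 : ℚ) ≤ |finRateQ R i σ c| * hτ + |(R i : ℚ)| * hx :=
        add_nonneg (mul_nonneg (abs_nonneg _) hhτ) (mul_nonneg (abs_nonneg _) hhx)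
      exact_mod_cast this
    have h0 := tailFactor_nonneg m ht0
    calc Real.exp ((((-(τ₀ * finRateQ R i σ c)) : ℚ) : ℝ)) * tailFactor m ((((|finRateQ R i σ c| * hτ + |(R i : ℚ)| * hx) : ℚ) : ℝ)) * ‖K R‖
        ≤ Real.exp ((((-(τ₀ * finRateQ R i σ c)) : ℚ) : ℝ)) * tailFactor m ((((|finRateQ R i σ c| * hτ + |(R i : ℚ)| * hx) : ℚ) : ℝ)) * ν R :=
          mul_le_mul_of_nonneg_left (hν R hRS) (mul_nonneg (Real.exp_pos _).le h0)
      _ = ((ν R : ℚ) : ℝ) * tailFactor m ((((|finRateQ R i σ c| * hτ + |(R i : ℚ)| * hx) : ℚ) : ℝ))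
            * Real.exp ((((-(τ₀ * finRateQ R i σ c)) : ℚ) : ℝ)) := by ring
  refine (sum_toFinset_le_sum_map L _ fun R hR => ?_).trans (List.sum_le_sum fun R hR => hterm R hR)
  refine mul_nonneg (mul_nonneg (Real.exp_pos _).le (tailFactor_nonneg m ?_)) (norm_nonneg _)
  exact add_nonneg (mul_nonneg (abs_nonneg _) (by exact_mod_cast hhτ)) (mul_nonneg (abs_nonneg _) (by exact_mod_cast hhx))

/-- **THE FIN TAIL FROM ONE KERNEL CHECK**. [folklore] -/
theorem taylorTailFin_le_of_checkUB {m : ℕ} {L : List (Fin (d + 1) → ℤ)} {S : Finset (Fin (d + 1) → ℤ)} (hLS : L.toFinset = S)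
    {K : (Fin (d + 1) → ℤ) → Matrix n n ℂ} {ν : (Fin (d + 1) → ℤ) → ℚ} (hν : ∀ x ∈ S, ‖K x‖ ≤ ν x)
    (i : Fin (d + 1)) (σ : ℚ) (c : Fin d → ℚ) (τ₀ : ℚ) {hτ hx : ℚ} (hhτ : 0 ≤ hτ) (hhx : 0 ≤ hx)
    {Sc Kt kt : ℕ} (hSc : 0 < Sc) {T : ℚ} (hcheck : checkUB Sc Kt kt (finTailTerms m L ν i σ c τ₀ hτ hx) T.num T.den = true) :
    taylorTailFin m S K i (σ : ℝ) (fun k => ((c k : ℚ) : ℝ)) (τ₀ : ℝ) (hτ : ℝ) (hx : ℝ) ≤ (T : ℝ) :=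
  (taylorTailFin_le_esum hLS hν i σ c τ₀ hhτ hhx).trans (esum_le_rat_of_checkUB hSc hcheck)

end FinTail

end

end Summit.QuantumFields.BalabanUV.Beta.StencilExpSums

namespace Summit.QuantumFields.BalabanUV.Beta.ResolventFinLeafRecord

open Complex Set Matrix Finset
open Summit.QuantumFields.BalabanUV.Beta.PolyRegularAlgebra (character)
open Summit.QuantumFields.BalabanUV.Beta.ResolventBoxCertificate
open Summit.QuantumFields.BalabanUV.Beta.ResolventFinCertificate
open Summit.QuantumFields.BalabanUV.Beta.StencilExpSums
open Literature.Analysis.ValidatedNumerics.ExpSum (checkUB)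
open scoped Real Matrix.Norms.L2Operator Pointwise

noncomputable section

variable {d : ℕ} {n : Type*} [Fintype n] [DecidableEq n] [DecidableEq (Fin (1 + 1) → ℕ)]

/-- **THE ADMITTED FIN RECORD CERTIFIES ITS RECTANGLE FROM COEFFICIENT DATA AND TABLE NORMS — ITS `T` FIELD CHECKED, NOT ASSERTED**: as
`FinLeafRecord.certifies_ofCoeffs` (p235048) with `hT : taylorTailFin ≤ r.T` REPLACED by the offset list, table norms and
`checkUB Sc Kt kt (finTailTerms r.m L ν i σ c τ₀ hτ hx) r.T.num r.T.den = true` (rational fin data `σ, c, τ₀, hτ, hx`). [folklore] -/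
theorem FinLeafRecord.certifies_ofCoeffs_ofTableNorms (r : FinLeafRecord) (hv : r.Valid)
    {L : List (Fin (d + 1) → ℤ)} {S : Finset (Fin (d + 1) → ℤ)} (hLS : L.toFinset = S)
    (K : (Fin (d + 1) → ℤ) → Matrix n n ℂ) (i : Fin (d + 1)) (σ : ℚ) (c : Fin d → ℚ) {τ₀ x₀ hτ hx : ℚ}
    (hsmall : ∀ R ∈ S, |finRate R i (σ : ℝ) (fun k => ((c k : ℚ) : ℝ))| * (hτ : ℝ) + |(R i : ℝ)| * (hx : ℝ) ≤ 1)
    (T_P : Finset (Fin (1 + 1) → ℕ)) (Z : (Fin (1 + 1) → ℕ) → Matrix n n ℂ)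
    (hE : ∑ γ ∈ insert 0 (T_P + degLT 1 r.m), monomial γ (![(hτ : ℝ), (hx : ℝ)] : Fin (1 + 1) → ℝ) *
      ‖finResidualCoeff T_P Z r.m S K i (σ : ℝ) (fun k => ((c k : ℚ) : ℝ)) (τ₀ : ℝ) (x₀ : ℝ) γ‖ ≤ r.ε)
    (hP : ∑ β ∈ T_P, monomial β (![(hτ : ℝ), (hx : ℝ)] : Fin (1 + 1) → ℝ) * ‖Z β‖ ≤ r.p)
    {ν : (Fin (d + 1) → ℤ) → ℚ} (hν : ∀ x ∈ S, ‖K x‖ ≤ ν x)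
    {Sc Kt kt : ℕ} (hSc : 0 < Sc) (hcheck : checkUB Sc Kt kt (finTailTerms r.m L ν i σ c τ₀ hτ hx) r.T.num r.T.den = true) :
    ∀ τ x : ℝ, |τ - (τ₀ : ℝ)| ≤ (hτ : ℝ) → |x - (x₀ : ℝ)| ≤ (hx : ℝ) →
      IsUnit (∑ R ∈ S, character R (i.insertNth ((x : ℂ) + ((τ * (σ : ℝ) : ℝ) : ℂ) * I)
        fun j => ((τ * ((c j : ℚ) : ℝ) : ℝ) : ℂ) * I) • K R).det ∧
        ‖(∑ R ∈ S, character R (i.insertNth ((x : ℂ) + ((τ * (σ : ℝ) : ℝ) : ℂ) * I)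
          fun j => ((τ * ((c j : ℚ) : ℝ) : ℝ) : ℂ) * I) • K R)⁻¹‖ ≤ (r.p : ℝ) / (1 - r.θ) := by
  intro τ x hτ' hx'
  have hhτ : 0 ≤ hτ := by
    have : (0 : ℝ) ≤ (hτ : ℝ) := (abs_nonneg _).trans hτ'
    exact_mod_cast this
  have hhx : 0 ≤ hx := by
    have : (0 : ℝ) ≤ (hx : ℝ) := (abs_nonneg _).trans hx'
    exact_mod_cast this
  have hT := taylorTailFin_le_of_checkUB (m := r.m) hLS hν i σ c τ₀ hhτ hhx hSc hcheck
  exact r.certifies_ofCoeffs hv S K i (σ : ℝ) (fun k => ((c k : ℚ) : ℝ)) hsmall T_P Z hE hP hT τ x hτ' hx'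

end

end Summit.QuantumFields.BalabanUV.Beta.ResolventFinLeafRecord

/-! ## §5 The (Z2b) table sups on the tube ∕ the vertex tori as an exponential sum -/

namespace Summit.QuantumFields.BalabanUV.Beta.StencilExpSums

open Complex Set Matrix Finset
open Summit.QuantumFields.BalabanUV.Beta.PolyRegularAlgebra (character)
open Summit.QuantumFields.BalabanUV.Beta.TubeMaximumModulus (Tube VertexTori polyStrip_subset_tube vertexTori_subset_polyStrip)
open Summit.QuantumFields.BalabanUV.Beta.ResolventBoxCertificate
open Summit.QuantumFields.BalabanUV.Beta.CapRouteA (norm_characterSum_le_of_mem_tube)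
open Literature.Analysis.ValidatedNumerics.ExpSum (ETerm esum checkUB checkLB esum_le_of_checkUB le_esum_of_checkLB)
open scoped Real Matrix.Norms.L2Operator Pointwise

noncomputable section

variable {d : ℕ} {n : Type*} [Fintype n] [DecidableEq n]

section TubeSup

/-- THE TERM LIST OF THE TUBE SUP: per offset `x` the term `ν_x · e^{Σ_μ |x_μ| w_μ}`. [folklore] -/
def tubeTerms (L : List (Fin (d + 1) → ℤ)) (ν : (Fin (d + 1) → ℤ) → ℚ) (w : Fin (d + 1) → ℚ) : List ETerm :=
  L.map fun x => ratTerm (ν x) (absDotQ x w)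

/-- **A STENCIL FAMILY ON THE TUBE IS BOUNDED BY THE EXPONENTIAL SUM OF ITS TERM LIST**: `|Im p_μ| ≤ w_μ` ⟹
`‖Σ_{x∈S} χ_p(x) • K x‖ ≤ esum (tubeTerms L ν w)`. [folklore] -/
theorem norm_characterSum_le_esum_of_mem_tube {L : List (Fin (d + 1) → ℤ)} {S : Finset (Fin (d + 1) → ℤ)} (hLS : L.toFinset = S)
    {K : (Fin (d + 1) → ℤ) → Matrix n n ℂ} {ν : (Fin (d + 1) → ℤ) → ℚ} (hν : ∀ x ∈ S, ‖K x‖ ≤ ν x)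
    {w : Fin (d + 1) → ℚ} {wr : Fin (d + 1) → ℝ} (hw : ∀ μ, wr μ = ((w μ : ℚ) : ℝ))
    {p : Fin (d + 1) → ℂ} (hp : p ∈ Tube wr) :
    ‖∑ x ∈ S, character x p • K x‖ ≤ esum (tubeTerms L ν w) := by
  refine (norm_characterSum_le_of_mem_tube S K hp).trans ?_
  rw [tubeTerms, esum_map_ratTerm, ← hLS]
  have hterm : ∀ x ∈ L, Real.exp (∑ μ, |(x μ : ℝ)| * wr μ) * ‖K x‖ ≤ ((ν x : ℚ) : ℝ) * Real.exp ((absDotQ x w : ℚ) : ℝ) := by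
    intro x hx
    have hxS : x ∈ S := by rw [← hLS, List.mem_toFinset]; exact hx
    have e1 : (∑ μ, |(x μ : ℝ)| * wr μ) = ((absDotQ x w : ℚ) : ℝ) := by
      rw [cast_absDotQ]; exact Finset.sum_congr rfl fun μ _ => by rw [hw]
    rw [e1, mul_comm]
    exact mul_le_mul_of_nonneg_right (hν x hxS) (Real.exp_pos _).le
  refine (sum_toFinset_le_sum_map L _ fun x _ => ?_).trans (List.sum_le_sum fun x hx => hterm x hx)
  exact mul_nonneg (Real.exp_pos _).le (norm_nonneg _)

/-- the same on the vertex tori of equal half-widths `κ`. [folklore] -/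
theorem norm_characterSum_le_esum_of_mem_vertexTori {L : List (Fin (d + 1) → ℤ)} {S : Finset (Fin (d + 1) → ℤ)}
    (hLS : L.toFinset = S) {K : (Fin (d + 1) → ℤ) → Matrix n n ℂ} {ν : (Fin (d + 1) → ℤ) → ℚ} (hν : ∀ x ∈ S, ‖K x‖ ≤ ν x)
    {κ : ℚ} {p : Fin (d + 1) → ℂ} (hp : p ∈ VertexTori (fun _ : Fin (d + 1) => ((κ : ℚ) : ℝ))) :
    ‖∑ x ∈ S, character x p • K x‖ ≤ esum (tubeTerms L ν fun _ => κ) :=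
  norm_characterSum_le_esum_of_mem_tube hLS hν (wr := fun _ => ((κ : ℚ) : ℝ)) (fun _ => rfl)
    (polyStrip_subset_tube _ (vertexTori_subset_polyStrip _ hp))

/-- **THE (Z2b) BINDER FROM ONE KERNEL CHECK**: `checkUB Sc Kt kt (tubeTerms L ν (fun _ => κ)) Sκ.num Sκ.den = true` ⟹
`∀ q ∈ VertexTori κ, ‖Σ_{x∈S} χ_q(x) • K x‖ ≤ Sκ` — literally the shape of `hS i` in `CapWordListGL(Schedules).rowsGL_ofSchedulesQ_ofPairedBall`
for a stencil letter, from table norms. [folklore] -/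
theorem tableSup_of_checkUB {L : List (Fin (d + 1) → ℤ)} {S : Finset (Fin (d + 1) → ℤ)} (hLS : L.toFinset = S)
    {K : (Fin (d + 1) → ℤ) → Matrix n n ℂ} {ν : (Fin (d + 1) → ℤ) → ℚ} (hν : ∀ x ∈ S, ‖K x‖ ≤ ν x) {κ : ℚ}
    {Sc Kt kt : ℕ} (hSc : 0 < Sc) {Sκ : ℚ} (hcheck : checkUB Sc Kt kt (tubeTerms L ν fun _ => κ) Sκ.num Sκ.den = true) :
    ∀ q ∈ VertexTori (fun _ : Fin (d + 1) => ((κ : ℚ) : ℝ)), ‖∑ x ∈ S, character x q • K x‖ ≤ ((Sκ : ℚ) : ℝ) :=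
  fun _ hq => (norm_characterSum_le_esum_of_mem_vertexTori hLS hν hq).trans (esum_le_rat_of_checkUB hSc hcheck)

/-- and on the whole closed tube `|Im q_μ| ≤ w_μ` (any rational half-widths). [folklore] -/
theorem tubeSup_of_checkUB {L : List (Fin (d + 1) → ℤ)} {S : Finset (Fin (d + 1) → ℤ)} (hLS : L.toFinset = S)
    {K : (Fin (d + 1) → ℤ) → Matrix n n ℂ} {ν : (Fin (d + 1) → ℤ) → ℚ} (hν : ∀ x ∈ S, ‖K x‖ ≤ ν x) {w : Fin (d + 1) → ℚ}
    {Sc Kt kt : ℕ} (hSc : 0 < Sc) {M : ℚ} (hcheck : checkUB Sc Kt kt (tubeTerms L ν w) M.num M.den = true) :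
    ∀ q ∈ Tube (fun μ => ((w μ : ℚ) : ℝ)), ‖∑ x ∈ S, character x q • K x‖ ≤ ((M : ℚ) : ℝ) :=
  fun _ hq => (norm_characterSum_le_esum_of_mem_tube hLS hν (fun _ => rfl) hq).trans (esum_le_rat_of_checkUB hSc hcheck)

end TubeSup

/-! ## §6 Worked kernel instance: the 81-offset nearest-neighbour stencil `{−1,0,1}⁴` -/

section Instance

/-- the 81 offsets of `{−1,0,1}⁴`, listed by base-3 digits (a generic unit-range stencil support in `d + 1 = 4` dimensions). [folklore] -/
def L81 : List (Fin (3 + 1) → ℤ) := (List.range 81).map fun k μ => ((((k / 3 ^ (μ : ℕ)) % 3 : ℕ) : ℤ)) - 1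

-- `decide +kernel` below unfolds `checkUB` on 81 terms (multi-precision interval `exp` at scale `2^64`, 24 Taylor terms, 6 halvings)
set_option maxRecDepth 100000

/-- KERNEL CHECK (tail, upper): the sign-free order-4 tail list of `L81` with unit table norms, `κ = 9∕10`, `h ≡ 1∕8` sums to `≤ 243∕100`. [folklore] -/
theorem tail81_checkUB :
    checkUB (2 ^ 64) 24 6 (tailTermsSup 4 L81 (fun _ => 1) (9 / 10) fun _ => 1 / 8) (243 / 100 : ℚ).num (243 / 100 : ℚ).den = true := by
  decide +kernel

/-- KERNEL CHECK (tail, lower): the same sum is `≥ 242∕100` — the enclosure is tight to 1∕100 (the true value is `2.4263…`). [folklore] -/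
theorem tail81_checkLB :
    checkLB (2 ^ 64) 24 6 (tailTermsSup 4 L81 (fun _ => 1) (9 / 10) fun _ => 1 / 8) (242 / 100 : ℚ).num (242 / 100 : ℚ).den = true := by
  decide +kernel

/-- KERNEL CHECK (tube sup, upper): `Σ_{x ∈ L81} e^{(9∕10)|x|₁} ≤ 1228` (`= (1 + 2e^{0.9})⁴ = 1227.6…`). [folklore] -/
theorem tube81_checkUB :
    checkUB (2 ^ 64) 24 6 (tubeTerms L81 (fun _ => 1) fun _ => 9 / 10) (1228 : ℚ).num (1228 : ℚ).den = true := by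
  decide +kernel

/-- KERNEL CHECK (tube sup, lower): the same sum is `≥ 1227`. [folklore] -/
theorem tube81_checkLB :
    checkLB (2 ^ 64) 24 6 (tubeTerms L81 (fun _ => 1) fun _ => 9 / 10) (1227 : ℚ).num (1227 : ℚ).den = true := by
  decide +kernel

/-- **WORKED INSTANCE (tail)**: for EVERY table `K` on the support `L81` with `‖K x‖ ≤ 1` and EVERY centre on the tube `|Im c_μ| ≤ 9∕10`, the order-4
Taylor tail on a box of half-widths `1∕8` is at most `243∕100` — a kernel theorem with no `exp` evaluated outside the kernel. [folklore] -/
theorem taylorTail_L81_le {K : (Fin (3 + 1) → ℤ) → Matrix n n ℂ} (hK : ∀ x ∈ L81.toFinset, ‖K x‖ ≤ 1) {c : Fin (3 + 1) → ℂ}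
    (hc : ∀ μ, |(c μ).im| ≤ 9 / 10) : taylorTail 4 L81.toFinset K c (fun _ => 1 / 8) ≤ 243 / 100 := by
  have hν : ∀ x ∈ L81.toFinset, ‖K x‖ ≤ (((fun _ => 1 : (Fin (3 + 1) → ℤ) → ℚ) x : ℚ) : ℝ) := fun x hx => by
    simpa using hK x hx
  have e : (((9 / 10 : ℚ)) : ℝ) = 9 / 10 := by norm_num
  have hc' : ∀ μ, |(c μ).im| ≤ (((9 / 10 : ℚ)) : ℝ) := fun μ => by rw [e]; exact hc μ
  have h := taylorTail_le_of_checkUB_sup rfl hν hc' (h := fun _ => 1 / 8) (fun _ => by norm_num) (hr := fun _ => 1 / 8)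
    (fun _ => by norm_num) (by norm_num) tail81_checkUB
  exact h.trans (by norm_num)

/-- the same tail sum is at least `242∕100` when the table norms are ATTAINED (`‖K x‖ = 1`) at a vertex-torus centre with the all-minus sign pattern —
recorded only as the exponential-sum statement `242∕100 ≤ esum (tailTermsSup …)` (tightness of the enclosure, not a statement about any table). [folklore] -/
theorem le_esum_tail81 : ((242 / 100 : ℚ) : ℝ) ≤ esum (tailTermsSup 4 L81 (fun _ => 1) (9 / 10) fun _ => 1 / 8) :=
  rat_le_esum_of_checkLB (by norm_num) tail81_checkLB

/-- **WORKED INSTANCE (tube sup)**: for EVERY table `K` on `L81` with `‖K x‖ ≤ 1`, `‖Σ_x χ_q(x) • K x‖ ≤ 1228` on the vertex tori `|Im q_μ| = 9∕10` —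
the (Z2b) binder shape, kernel-checked. [folklore] -/
theorem tableSup_L81_le {K : (Fin (3 + 1) → ℤ) → Matrix n n ℂ} (hK : ∀ x ∈ L81.toFinset, ‖K x‖ ≤ 1) :
    ∀ q ∈ VertexTori (fun _ : Fin (3 + 1) => (9 / 10 : ℝ)), ‖∑ x ∈ L81.toFinset, character x q • K x‖ ≤ 1228 := by
  have hν : ∀ x ∈ L81.toFinset, ‖K x‖ ≤ (((fun _ => 1 : (Fin (3 + 1) → ℤ) → ℚ) x : ℚ) : ℝ) := fun x hx => by
    simpa using hK x hx
  have h := tableSup_of_checkUB rfl hν (by norm_num) tube81_checkUB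
  have e : (((9 / 10 : ℚ)) : ℝ) = 9 / 10 := by norm_num
  intro q hq
  have h' := h q (by rwa [e])
  exact h'.trans (by norm_num)

/-- tightness of the tube enclosure: `1227 ≤ esum (tubeTerms L81 1 (9∕10))`. [folklore] -/
theorem le_esum_tube81 : ((1227 : ℚ) : ℝ) ≤ esum (tubeTerms L81 (fun _ => 1) fun _ => 9 / 10) :=
  rat_le_esum_of_checkLB (by norm_num) tube81_checkLB

end Instance

end

end Summit.QuantumFields.BalabanUV.Beta.StencilExpSums
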